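import Mathlib
import HarnessLib
import Summits.NavierStokesRegularity.NavierStokesRegularity.Theorems.TypeIQuarterGateScarEnvelopeTypeIForcedTsaiHomogeneousTailScaling
import Summits.NavierStokesRegularity.NavierStokesRegularity.Theorems.TypeIQuarterGateScarEnvelopeTypeIForcedTsaiLandauTail

/-!
# ARM B — REGISTERED TAIL DICHOTOMY, part 2 (`…TailDichotomyShells`): DYADIC SHELLS — the registered residual of a field with
  an exactly `(−1)`-homogeneous far field VANISHES outside the ball (ns-wall-extremal; (C2) of
  LINEAR-FLOOR §3 / DATUM B-2k, kernel)

Cell ns-wall-extremal, seat ns-wall-eng-1 g7.  Part 1 (`…HomogeneousTailScaling`) proved the DYADIC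
LAW `g_U(2^k y) = 2^{−4k} g_U(y)` outside the ball for a `C¹` field `U` coinciding there with an
exactly `(−1)`-homogeneous `V`.  Here:

* a self-contained measure-theoretic lemma on `ℝ³` (`section Dyadic`): a CONTINUOUS nonnegative
  density `φ`, integrable on `{ρ < ‖y‖}` and obeying `φ(2y) = φ(y)/8` there, VANISHES there
  (`eq_zero_of_dyadic_of_integrable`) — every dyadic shell `A_k = 2^k • A_0` carries the same mass
  (`setIntegral_shell_eq`, Mathlib `Measure.setIntegral_comp_smul_of_pos`), `N` equal masses are
  bounded by the total (`setIntegral_shell_eq_zero`), and a continuous function vanishing a.e. on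
  an open set vanishes (`Metric.measure_ball_pos`);
* ★★ `lerayVorticityResidual_eq_zero_of_homogeneousTail`: for `U ∈ C³` with `U = V` on `{ρ < ‖y‖}`
  (`ρ ≥ 0`, `V` exactly `(−1)`-homogeneous) and the registered weighted residual density
  `(1+‖y‖)⁵‖g_U‖²` INTEGRABLE (the currency's integrability conjunct), `g_U ≡ 0` on `{ρ < ‖y‖}` —
  applied to `φ = ‖y‖⁵‖g_U‖²` (continuous by p702146 `continuous_lerayVorticityResidual`): the
  «log-divergence of exactly homogeneous tails» of LINEAR-FLOOR §3 made exact and class-free.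

Part 3 (`…ForcedTsaiTailDichotomy`) concludes: `V` solves the steady Navier–Stokes system on `ℝ³ ∖ {0}`
and is therefore (Šverák 2011, proved in the tree) a Landau solution or zero.

HONEST FRAME.  Structural helper about the registered CURRENCY (`--supports
stmt-NavierStokesRegularity-23843`): it says which exactly-homogeneous far fields a finite-residual
near-profile can have; it excludes no near-profile with a non-homogeneous or faster-decaying tail
correction, bounds no modulus, changes no number of record.  Crux `ScarEnvelopeTypeI` (stmt-23843) /
wall H3 OPEN; NS regularity NOT proved.
-/

noncomputable section

set_option linter.dupNamespace false

namespace Summit.NavierStokesRegularity.NavierStokesRegularity.Cruxes.ScarEnvelopeTypeI.ForcedTsai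

open MeasureTheory Set Metric Filter Topology
open scoped ContDiff Laplacian InnerProductSpace RealInnerProductSpace Pointwise
open Literature.Analysis.FluidPDE

namespace TailDichotomy

variable {V U : E3 → E3} {ρ : ℝ}
/-! ## Part 2 — DYADIC SHELLS: an integrable density with the dyadic law `φ(2y) = φ(y)/8` vanishes -/

section Dyadic

/-- The dyadic shells `A_k(ρ') = {2^k ρ' ≤ ‖y‖ < 2^{k+1} ρ'}`. (Local notation via a plain function.) -/
theorem mem_shell_iff (ρ' : ℝ) (k : ℕ) (y : E3) :
    y ∈ {y : E3 | (2 : ℝ) ^ k * ρ' ≤ ‖y‖ ∧ ‖y‖ < (2 : ℝ) ^ (k + 1) * ρ'}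
      ↔ (2 : ℝ) ^ k * ρ' ≤ ‖y‖ ∧ ‖y‖ < (2 : ℝ) ^ (k + 1) * ρ' := Iff.rfl

/-- The shells are measurable. -/
theorem measurableSet_shell (ρ' : ℝ) (k : ℕ) :
    MeasurableSet {y : E3 | (2 : ℝ) ^ k * ρ' ≤ ‖y‖ ∧ ‖y‖ < (2 : ℝ) ^ (k + 1) * ρ'} :=
  (measurableSet_le measurable_const measurable_norm).inter
    (measurableSet_lt measurable_norm measurable_const)

/-- The `k`-th shell is the `2^k`-dilate of the `0`-th shell. -/
theorem shell_eq_smul_shell_zero {ρ' : ℝ} (k : ℕ) :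
    {y : E3 | (2 : ℝ) ^ k * ρ' ≤ ‖y‖ ∧ ‖y‖ < (2 : ℝ) ^ (k + 1) * ρ'}
      = ((2 : ℝ) ^ k) • {y : E3 | (2 : ℝ) ^ 0 * ρ' ≤ ‖y‖ ∧ ‖y‖ < (2 : ℝ) ^ (0 + 1) * ρ'} := by
  have hc : (0 : ℝ) < (2 : ℝ) ^ k := by positivity
  ext y
  rw [Set.mem_smul_set_iff_inv_smul_mem₀ hc.ne', Set.mem_setOf_eq, Set.mem_setOf_eq, norm_smul,
    Real.norm_of_nonneg (inv_nonneg.mpr hc.le), pow_zero, one_mul, zero_add, pow_one]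
  rw [le_inv_mul_iff₀ hc, inv_mul_lt_iff₀ hc, pow_succ]
  constructor
  · rintro ⟨h1, h2⟩; exact ⟨by linarith, by linarith⟩
  · rintro ⟨h1, h2⟩; exact ⟨by linarith, by linarith⟩

/-- The shells are pairwise disjoint. -/
theorem pairwise_disjoint_shell {ρ' : ℝ} (hρ' : 0 < ρ') :
    Pairwise (Function.onFun Disjoint
      fun k : ℕ => {y : E3 | (2 : ℝ) ^ k * ρ' ≤ ‖y‖ ∧ ‖y‖ < (2 : ℝ) ^ (k + 1) * ρ'}) := by
  intro i j hij
  rw [Function.onFun, Set.disjoint_left]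
  rintro y ⟨hi1, hi2⟩ ⟨hj1, hj2⟩
  rcases lt_or_gt_of_ne hij with h | h
  · have : (2 : ℝ) ^ (i + 1) * ρ' ≤ (2 : ℝ) ^ j * ρ' := by
      gcongr
      · norm_num
      · omega
    linarith
  · have : (2 : ℝ) ^ (j + 1) * ρ' ≤ (2 : ℝ) ^ i * ρ' := by
      gcongr
      · norm_num
      · omega
    linarith

/-- Every point with `ρ' ≤ ‖y‖` (`ρ' > 0`) lies in some shell. -/
theorem exists_mem_shell {ρ' : ℝ} (hρ' : 0 < ρ') {y : E3} (hy : ρ' ≤ ‖y‖) :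
    ∃ k : ℕ, y ∈ {y : E3 | (2 : ℝ) ^ k * ρ' ≤ ‖y‖ ∧ ‖y‖ < (2 : ℝ) ^ (k + 1) * ρ'} := by
  have h1 : (1 : ℝ) ≤ ‖y‖ / ρ' := by rwa [le_div_iff₀ hρ', one_mul]
  obtain ⟨k, hk1, hk2⟩ := exists_nat_pow_near h1 (by norm_num : (1 : ℝ) < 2)
  refine ⟨k, ?_, ?_⟩
  · have := (le_div_iff₀ hρ').mp hk1
    linarith
  · have := (div_lt_iff₀ hρ').mp hk2
    linarith

/-- Iterating the dyadic law: `φ(2^k • y) = (8^k)⁻¹ φ(y)` for `ρ < ‖y‖` (`ρ ≥ 0`). -/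
theorem dyadic_iterate {φ : E3 → ℝ} (hρ : 0 ≤ ρ)
    (hdy : ∀ y : E3, ρ < ‖y‖ → φ ((2 : ℝ) • y) = 8⁻¹ * φ y) {y : E3} (hy : ρ < ‖y‖) (k : ℕ) :
    φ ((2 : ℝ) ^ k • y) = ((8 : ℝ) ^ k)⁻¹ * φ y := by
  induction k with
  | zero => simp
  | succ k ih =>
    have hk : ρ < ‖(2 : ℝ) ^ k • y‖ := by
      rw [norm_smul, Real.norm_of_nonneg (by positivity)]
      have h1 : (1 : ℝ) ≤ (2 : ℝ) ^ k := one_le_pow₀ (by norm_num)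
      have : ‖y‖ ≤ (2 : ℝ) ^ k * ‖y‖ := le_mul_of_one_le_left (le_trans hρ hy.le) h1
      linarith
    rw [pow_succ, mul_comm ((2 : ℝ) ^ k) 2, mul_smul, hdy _ hk, ih, pow_succ, mul_inv]
    ring

/-- **DYADIC SHELL LEMMA.**  A nonnegative integrable density on `{ρ < ‖y‖}` obeying the dyadic law
`φ(2y) = φ(y)/8` there gives the SAME mass to every dyadic shell
`A_k(ρ') = {2^k ρ' ≤ ‖y‖ < 2^{k+1} ρ'}` (`ρ' > ρ ≥ 0`): `∫_{A_k} φ = ∫_{A_0} φ`. -/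
theorem setIntegral_shell_eq {φ : E3 → ℝ} (hρ : 0 ≤ ρ) {ρ' : ℝ} (hρ' : ρ < ρ')
    (hdy : ∀ y : E3, ρ < ‖y‖ → φ ((2 : ℝ) • y) = 8⁻¹ * φ y) (k : ℕ) :
    ∫ y in {y : E3 | (2 : ℝ) ^ k * ρ' ≤ ‖y‖ ∧ ‖y‖ < (2 : ℝ) ^ (k + 1) * ρ'}, φ y
      = ∫ y in {y : E3 | (2 : ℝ) ^ 0 * ρ' ≤ ‖y‖ ∧ ‖y‖ < (2 : ℝ) ^ (0 + 1) * ρ'}, φ y := by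
  set A0 : Set E3 := {y : E3 | (2 : ℝ) ^ 0 * ρ' ≤ ‖y‖ ∧ ‖y‖ < (2 : ℝ) ^ (0 + 1) * ρ'} with hA0
  have hc : (0 : ℝ) < (2 : ℝ) ^ k := by positivity
  have hρ'0 : 0 < ρ' := lt_of_le_of_lt hρ hρ'
  -- change of variables `y = 2^k • x` on `A0`
  have hcov := MeasureTheory.Measure.setIntegral_comp_smul_of_pos
    (volume : Measure E3) φ A0 hc
  rw [finrank_euclideanSpace_fin] at hcov
  -- on `A0`, `φ (2^k • x) = (8^k)⁻¹ φ x`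
  have hA0sub : ∀ x ∈ A0, ρ < ‖x‖ := by
    intro x hx
    rw [hA0, Set.mem_setOf_eq, pow_zero, one_mul] at hx
    exact lt_of_lt_of_le hρ' hx.1
  have hleft : ∫ x in A0, φ ((2 : ℝ) ^ k • x) = ((8 : ℝ) ^ k)⁻¹ * ∫ x in A0, φ x := by
    rw [← integral_const_mul]
    refine setIntegral_congr_fun (by rw [hA0]; exact measurableSet_shell ρ' 0) fun x hx => ?_
    exact dyadic_iterate hρ hdy (hA0sub x hx) k
  rw [hleft, ← shell_eq_smul_shell_zero k, smul_eq_mul] at hcov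
  have h8 : ((2 : ℝ) ^ k) ^ 3 = (8 : ℝ) ^ k := by
    rw [← pow_mul, mul_comm, pow_mul]; norm_num
  rw [h8] at hcov
  have h8k : ((8 : ℝ) ^ k)⁻¹ ≠ 0 := inv_ne_zero (pow_ne_zero k (by norm_num))
  exact (mul_left_cancel₀ h8k hcov).symm

/-- **Every shell has mass zero**: for `φ ≥ 0` integrable on `{ρ < ‖y‖}` with the dyadic law,
`∫_{A_k(ρ')} φ = 0` (`ρ' > ρ ≥ 0`): `N` equal masses are bounded by the total, for every `N`. -/
theorem setIntegral_shell_eq_zero {φ : E3 → ℝ} (hρ : 0 ≤ ρ) {ρ' : ℝ} (hρ' : ρ < ρ')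
    (hnn : ∀ y, 0 ≤ φ y) (hint : IntegrableOn φ {y : E3 | ρ < ‖y‖})
    (hdy : ∀ y : E3, ρ < ‖y‖ → φ ((2 : ℝ) • y) = 8⁻¹ * φ y) (k : ℕ) :
    ∫ y in {y : E3 | (2 : ℝ) ^ k * ρ' ≤ ‖y‖ ∧ ‖y‖ < (2 : ℝ) ^ (k + 1) * ρ'}, φ y = 0 := by
  set A : ℕ → Set E3 :=
    fun k => {y : E3 | (2 : ℝ) ^ k * ρ' ≤ ‖y‖ ∧ ‖y‖ < (2 : ℝ) ^ (k + 1) * ρ'} with hA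
  have hρ'0 : 0 < ρ' := lt_of_le_of_lt hρ hρ'
  set s : ℝ := ∫ y in A 0, φ y with hs
  have hk : ∀ j, ∫ y in A j, φ y = s := fun j => setIntegral_shell_eq hρ hρ' hdy j
  -- each shell lies in the exterior region
  have hAsub : ∀ j, A j ⊆ {y : E3 | ρ < ‖y‖} := by
    intro j y hy
    have h1 : (1 : ℝ) ≤ (2 : ℝ) ^ j := one_le_pow₀ (by norm_num)
    have : ρ' ≤ (2 : ℝ) ^ j * ρ' := le_mul_of_one_le_left hρ'0.le h1
    exact lt_of_lt_of_le hρ' (le_trans this hy.1)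
  have hintA : ∀ j, IntegrableOn φ (A j) := fun j => hint.mono_set (hAsub j)
  -- N shells: N * s ≤ total
  set C : ℝ := ∫ y in {y : E3 | ρ < ‖y‖}, φ y with hC
  have hNs : ∀ N : ℕ, (N : ℝ) * s ≤ C := by
    intro N
    have hU : ∫ y in ⋃ j ∈ Finset.range N, A j, φ y = ∑ j ∈ Finset.range N, ∫ y in A j, φ y :=
      integral_biUnion_finset (Finset.range N) (fun j _ => measurableSet_shell ρ' j)
        (fun i _ j _ hij => pairwise_disjoint_shell hρ'0 hij) (fun j _ => hintA j)
    have hsum : ∑ j ∈ Finset.range N, ∫ y in A j, φ y = (N : ℝ) * s := by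
      rw [Finset.sum_congr rfl fun j _ => hk j, Finset.sum_const, Finset.card_range, nsmul_eq_mul]
    have hle : ∫ y in ⋃ j ∈ Finset.range N, A j, φ y ≤ C := by
      refine setIntegral_mono_set hint ?_ ?_
      · exact Filter.Eventually.of_forall fun y => hnn y
      · exact Filter.Eventually.of_forall (Set.iUnion₂_subset fun j _ => hAsub j)
    rw [hU, hsum] at hle
    exact hle
  -- hence s ≤ 0; and s ≥ 0
  have hs0 : 0 ≤ s := setIntegral_nonneg (measurableSet_shell ρ' 0) fun y _ => hnn y
  have hsle : s ≤ 0 := by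
    by_contra h
    push Not at h
    obtain ⟨N, hN⟩ := exists_nat_gt (C / s)
    have := hNs N
    rw [div_lt_iff₀ h] at hN
    linarith
  rw [hk k]
  exact le_antisymm hsle hs0

/-- **VANISHING.**  A CONTINUOUS nonnegative density, integrable on `{ρ < ‖y‖}` (`ρ ≥ 0`) and obeying
the dyadic law `φ(2y) = φ(y)/8` there, vanishes identically on `{ρ < ‖y‖}`. -/
theorem eq_zero_of_dyadic_of_integrable {φ : E3 → ℝ} (hρ : 0 ≤ ρ) (hcont : Continuous φ)
    (hnn : ∀ y, 0 ≤ φ y) (hint : IntegrableOn φ {y : E3 | ρ < ‖y‖})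
    (hdy : ∀ y : E3, ρ < ‖y‖ → φ ((2 : ℝ) • y) = 8⁻¹ * φ y) {y₀ : E3} (hy₀ : ρ < ‖y₀‖) :
    φ y₀ = 0 := by
  by_contra hne
  have hpos : 0 < φ y₀ := lt_of_le_of_ne (hnn y₀) (Ne.symm hne)
  -- an intermediate radius and the shells beyond it
  set ρ' : ℝ := (ρ + ‖y₀‖) / 2 with hρ'_def
  have hρ' : ρ < ρ' := by rw [hρ'_def]; linarith
  have hρ'0 : 0 < ρ' := lt_of_le_of_lt hρ hρ'
  have hρ'y : ρ' < ‖y₀‖ := by rw [hρ'_def]; linarith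
  set A : ℕ → Set E3 :=
    fun k => {y : E3 | (2 : ℝ) ^ k * ρ' ≤ ‖y‖ ∧ ‖y‖ < (2 : ℝ) ^ (k + 1) * ρ'} with hA
  -- the positivity set is open and null on every shell
  set P : Set E3 := {y : E3 | φ y ≠ 0} with hP
  have hPopen : IsOpen P := isOpen_ne_fun hcont continuous_const
  have hnull : ∀ k, volume (P ∩ A k) = 0 := by
    intro k
    have hAsub : A k ⊆ {y : E3 | ρ < ‖y‖} := by
      intro y hy
      have h1 : (1 : ℝ) ≤ (2 : ℝ) ^ k := one_le_pow₀ (by norm_num)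
      have : ρ' ≤ (2 : ℝ) ^ k * ρ' := le_mul_of_one_le_left hρ'0.le h1
      exact lt_of_lt_of_le hρ' (le_trans this hy.1)
    have hz := setIntegral_shell_eq_zero hρ hρ' hnn hint hdy k
    have hae : φ =ᵐ[volume.restrict (A k)] 0 :=
      (setIntegral_eq_zero_iff_of_nonneg_ae (Filter.Eventually.of_forall fun y => hnn y)
        (hint.mono_set hAsub)).mp hz
    have h2 : (volume.restrict (A k)) P = 0 := by
      rw [Filter.EventuallyEq, ae_iff] at hae
      simpa [hP] using hae
    rwa [Measure.restrict_apply hPopen.measurableSet] at h2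
  -- a small ball around `y₀` inside `P ∩ {ρ' ≤ ‖y‖}`
  obtain ⟨δ, hδ, hball⟩ : ∃ δ > 0, ball y₀ δ ⊆ P ∩ {y : E3 | ρ' ≤ ‖y‖} := by
    have hPn : P ∈ 𝓝 y₀ := hPopen.mem_nhds (by rw [hP]; exact hne)
    have hEn : {y : E3 | ρ' < ‖y‖} ∈ 𝓝 y₀ := (isOpen_exterior ρ').mem_nhds hρ'y
    obtain ⟨δ, hδ, hsub⟩ := Metric.mem_nhds_iff.mp (Filter.inter_mem hPn hEn)
    exact ⟨δ, hδ, fun y hy => ⟨(hsub hy).1, (le_of_lt (hsub hy).2 : ρ' ≤ ‖y‖)⟩⟩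
  -- the ball is covered by the shells, hence null: contradiction
  have hcover : ball y₀ δ ⊆ ⋃ k, (P ∩ A k) := by
    intro y hy
    obtain ⟨hyP, hyρ⟩ := hball hy
    obtain ⟨k, hk⟩ := exists_mem_shell hρ'0 hyρ
    exact Set.mem_iUnion.mpr ⟨k, hyP, hk⟩
  have hnullU : volume (⋃ k, (P ∩ A k)) = 0 := measure_iUnion_null hnull
  have hballnull : volume (ball y₀ δ) = 0 := measure_mono_null hcover hnullU
  exact absurd hballnull (Metric.measure_ball_pos volume y₀ hδ).ne'

end Dyadic

/-! ## Part 2 — the registered residual VANISHES outside the ball -/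

/-- ★★ **REGISTERED TAIL DICHOTOMY, vanishing half.**  Let `U ∈ C³(ℝ³;ℝ³)` coincide outside a closed
ball (`U = V` on `{ρ < ‖y‖}`, `ρ ≥ 0`) with an EXACTLY `(−1)`-homogeneous field `V`.  If the registered
weighted residual density `(1+‖y‖)⁵‖g_U‖²` is integrable (the currency's integrability conjunct),
then `g_U ≡ 0` outside the ball.  (The dyadic law `g_U(2y) = 2⁻⁴ g_U(y)` makes `‖y‖⁵‖g_U‖²` give
equal mass to every dyadic shell — the log-divergence of LINEAR-FLOOR §3 made exact.) -/
theorem lerayVorticityResidual_eq_zero_of_homogeneousTail (hU3 : ContDiff ℝ 3 U)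
    (hV : ∀ c : ℝ, 0 < c → ∀ y : E3, V (c • y) = c⁻¹ • V y) (hρ : 0 ≤ ρ)
    (hU : ∀ y : E3, ρ < ‖y‖ → U y = V y)
    (hint : Integrable (fun y : E3 => (1 + ‖y‖) ^ 5 * ‖lerayVorticityResidual U y‖ ^ 2))
    {y : E3} (hy : ρ < ‖y‖) : lerayVorticityResidual U y = 0 := by
  have hU1 : ContDiff ℝ 1 U := hU3.of_le (by norm_num)
  set φ : E3 → ℝ := fun y => ‖y‖ ^ 5 * ‖lerayVorticityResidual U y‖ ^ 2 with hφ
  have hcont : Continuous φ :=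
    (continuous_norm.pow 5).mul ((LandauTail.continuous_lerayVorticityResidual hU3).norm.pow 2)
  have hnn : ∀ z, 0 ≤ φ z := fun z => by positivity
  have hle : ∀ z : E3, φ z ≤ (1 + ‖z‖) ^ 5 * ‖lerayVorticityResidual U z‖ ^ 2 := by
    intro z
    have h5 : ‖z‖ ^ 5 ≤ (1 + ‖z‖) ^ 5 :=
      pow_le_pow_left₀ (norm_nonneg z) (by linarith [norm_nonneg z]) 5
    exact mul_le_mul_of_nonneg_right h5 (by positivity)
  have hintφ : Integrable φ := by
    refine hint.mono' hcont.aestronglyMeasurable (Filter.Eventually.of_forall fun z => ?_)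
    rw [Real.norm_of_nonneg (hnn z)]
    exact hle z
  have hdy : ∀ z : E3, ρ < ‖z‖ → φ ((2 : ℝ) • z) = 8⁻¹ * φ z := by
    intro z hz
    have h := lerayVorticityResidual_smul_of_tail hU1 hV hρ hU hz (by norm_num : (1 : ℝ) ≤ 2)
    simp only [hφ]
    rw [h, norm_smul, norm_smul, Real.norm_of_nonneg (by norm_num : (0 : ℝ) ≤ 2),
      Real.norm_of_nonneg (by norm_num : (0 : ℝ) ≤ ((2 : ℝ) ^ 4)⁻¹)]
    ring
  have h0 := eq_zero_of_dyadic_of_integrable hρ hcont hnn hintφ.integrableOn hdy hy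
  -- `‖y‖⁵ ‖g‖² = 0` with `‖y‖ > 0`
  have hy0 : 0 < ‖y‖ := lt_of_le_of_lt hρ hy
  simp only [hφ] at h0
  rcases mul_eq_zero.mp h0 with h1 | h1
  · exact absurd h1 (pow_ne_zero 5 hy0.ne')
  · exact norm_eq_zero.mp ((pow_eq_zero_iff two_ne_zero).mp h1)


end TailDichotomy

end Summit.NavierStokesRegularity.NavierStokesRegularity.Cruxes.ScarEnvelopeTypeI.ForcedTsai

end
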